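import Mathlib
import HarnessLib
import Literature.Analysis.FluidPDE.ClassicalSolution
import Literature.Analysis.FluidPDE.Vorticity
import Summits.NavierStokesRegularity.NavierStokesRegularity.Theorems.QuarterLogPincerBeadCensusDefs
import Summits.NavierStokesRegularity.NavierStokesRegularity.Theorems.QuarterLogPincerBeadCensusKernel
import Summits.NavierStokesRegularity.NavierStokesRegularity.Theorems.QuarterLogPincerCubicRungDefs
import Summits.NavierStokesRegularity.NavierStokesRegularity.Theorems.QuarterLogPincerThinCascadeDefs
import Summits.NavierStokesRegularity.NavierStokesRegularity.Theorems.QuarterLogPincerTypeIQuantSubcubicExpStubUniformScaledEnergy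
import Summits.NavierStokesRegularity.NavierStokesRegularity.Theorems.QuarterLogPincerTypeIQuantSubcubicExpFrameTools
import Summits.NavierStokesRegularity.NavierStokesRegularity.Theorems.QuarterLogPincerTypeIQuantSubcubicExpZoomEnergyA
import Summits.NavierStokesRegularity.NavierStokesRegularity.Theorems.QuarterLogPincerTypeIQuantSubcubicExpRescaleTools
import Summits.NavierStokesRegularity.NavierStokesRegularity.Theorems.QuarterLogPincerTypeIQuantSubcubicExpUnitScaleTools
import Summits.NavierStokesRegularity.NavierStokesRegularity.Theorems.QuarterLogPincerHelmholtzCentreDefs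
import Summits.NavierStokesRegularity.NavierStokesRegularity.Theorems.QuarterLogPincerHelmholtzCentreShellKernel
import Summits.NavierStokesRegularity.NavierStokesRegularity.Theorems.QuarterLogPincerFlatChainDefs
import Summits.NavierStokesRegularity.NavierStokesRegularity.Theorems.QuarterLogPincerFlatChainTypeIEpoch
import Literature.Analysis.FluidPDE.BarkerPrangeLocalizedSmoothingBounds
import Literature.Analysis.FluidPDE.BarkerPrangeConcentrationProofs
import Literature.Analysis.FluidPDE.BackwardHeatPointwise
import Literature.Analysis.FluidPDE.AncientWeakL3BackwardLiouvilleAssembly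
import Literature.Analysis.FluidPDE.LocalEnergySolutionsOn
import Literature.Analysis.FluidPDE.LocalLerayExistence
import Literature.Analysis.FluidPDE.BoundedMildWeakL3LocalEnergySolution
import Literature.Analysis.FluidPDE.BoundedMildWeakL3RieszPressure
import Literature.Analysis.FluidPDE.KatoLocalLerayPressureProofs
import Literature.Analysis.FluidPDE.VeryWeakToDistributional
import Literature.Analysis.FluidPDE.VeryWeakToDistributionalFour
import Literature.Analysis.FluidPDE.ClassicalBoundedWeak
import Literature.Analysis.FluidPDE.MildSolution
import Literature.Analysis.SingularIntegrals.HardyLittlewoodSobolev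
import Literature.Analysis.FluidPDE.VorticityCalculus
import Literature.Analysis.FluidPDE.BiotSavartWeakLp
import Summits.NavierStokesRegularity.NavierStokesRegularity.Theorems.QuarterLogPincerFlatChainSliceDefs
import Summits.NavierStokesRegularity.NavierStokesRegularity.Theorems.QuarterLogPincerFlatChainSliceFrame

/-!
# Route `QuarterLogPincer`, crux `TypeIQuantSubcubicExp` (stmt-NavierStokesRegularity-24077), line `flat_chain` —
# §10a (part B) + P♭♭: `sliceField_memLp_four`, `localEnergySliceLES_of_slicePressure`, `localEnergySlice_of_les`,
# ★ `slicePressure_holds : SlicePressure` (P♭♭ PROVED), and the registered names `stub_slicePressure`, `stub_localEnergySliceLES`,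
# `stub_localEnergySlice` (P PROVED) — the author's proofs VERBATIM

HONEST FRAME: ports of the author's kernel-checked in-file proofs about HYPOTHETICAL Type-I classical solutions; no census node,
⟨24077⟩, W7 or Navier–Stokes regularity is proved (OPEN).  pub-ns-dss typer (g39), `--supports stmt-NavierStokesRegularity-24077`;
texts by ns-idea-7 (g14), workfile `Cruxes/TypeIQuantSubcubicExp/Lines/flat_chain.lean` v1.12 (sha f4adcfe506ba), VERBATIM.
-/

set_option linter.dupNamespace false

namespace Summit.NavierStokesRegularity.NavierStokesRegularity.Cruxes.TypeIQuantSubcubicExp.FlatChain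

noncomputable section

open MeasureTheory Set Metric
open scoped ENNReal NNReal Classical
open Literature.Analysis Literature.Analysis.FluidPDE
open Summit.NavierStokesRegularity.NavierStokesRegularity.Cruxes.TypeIQuantSubcubicExp.BeadCensus
open Summit.NavierStokesRegularity.NavierStokesRegularity.Cruxes.TypeIQuantSubcubicExp.CubicRung

section PClauses

open Summit.NavierStokesRegularity.NavierStokesRegularity.Cruxes.TypeIQuantSubcubicExp.ThinCascade
  (TaoFrame UniformScaledEnergy stub_uniformScaledEnergy)
open Summit.NavierStokesRegularity.NavierStokesRegularity.Theorems.ThinCascade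
  (lintegral_sq_ball_zoom rescale_lintegral_sq rescale_rate exists_lintegral_sq_le_of_taoFrame frame_restrict typeI_restrict)

/-- **`L⁴` clause**: the slice field is in `L⁴` of the slab `(0,S) × ℝ³` (bounded × uniformly `L²` slices). [folklore] -/
theorem sliceField_memLp_four {M T τ : ℝ}
    {u : ℝ → EuclideanSpace ℝ (Fin 3) → EuclideanSpace ℝ (Fin 3)} {p : ℝ → EuclideanSpace ℝ (Fin 3) → ℝ}
    (hfr : TaoFrame T u p) (hτ : 0 < τ)
    (hrate : ∀ t ∈ Icc 0 T, ∀ y, ‖u t y‖ ≤ M * (T + τ - t) ^ (-(1 / 2 : ℝ)))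
    (x : EuclideanSpace ℝ (Fin 3)) {tstar r S : ℝ} (hr : 0 < r) (hS : 0 < S) (ht0 : 0 ≤ tstar)
    (hwin : tstar + S * r ^ 2 ≤ T) :
    MemLp (Function.uncurry (sliceField u x tstar r)) 4
      (volume.restrict (Ioo 0 S ×ˢ (univ : Set (EuclideanSpace ℝ (Fin 3))))) := by
  have hr2 : 0 < r ^ 2 := by positivity
  set v := sliceField u x tstar r with hv
  set slab : Set (ℝ × EuclideanSpace ℝ (Fin 3)) := Ioo 0 S ×ˢ univ with hslab
  have hmeas_slab : MeasurableSet slab := measurableSet_Ioo.prod MeasurableSet.univ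
  have hcont := sliceField_continuousOn hfr.1 x hr hS ht0 hwin
  have hcont' : ContinuousOn (Function.uncurry v) slab :=
    hcont.mono (prod_mono Ioo_subset_Icc_self Subset.rfl)
  have haesm : AEStronglyMeasurable (Function.uncurry v) (volume.restrict slab) :=
    hcont'.aestronglyMeasurable hmeas_slab
  refine ⟨haesm, ?_⟩
  have hK := sliceField_bound hrate hτ x hr ht0 hwin
  set K : ℝ := M * r * τ ^ (-(1 / 2 : ℝ)) with hKdef
  have hK0 : 0 ≤ K := le_trans (norm_nonneg _) (hK 0 ⟨le_rfl, hS.le⟩ 0)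
  obtain ⟨E₀, hE₀, hE⟩ := exists_lintegral_sq_le_of_taoFrame hfr
  obtain ⟨E₁, hE₁, hE1⟩ := rescale_lintegral_sq hr x hE₀ hE
  have hslice : ∀ σ ∈ Icc 0 S, ∫⁻ y, ‖v σ y‖ₑ ^ 2 ≤ E₁ := by
    intro σ hσ
    have hs : tstar / r ^ 2 + σ ∈ Icc 0 (T / r ^ 2) := by
      rw [show tstar / r ^ 2 + σ = (tstar + r ^ 2 * σ) / r ^ 2 by field_simp]
      exact ⟨div_nonneg (by nlinarith [hσ.1]) hr2.le, div_le_div_of_nonneg_right (by nlinarith [hσ.2]) hr2.le⟩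
    rw [hv, sliceField_eq_rescale_shift u x hr σ]
    exact hE1 _ hs
  have hprod : (volume.restrict slab : Measure (ℝ × EuclideanSpace ℝ (Fin 3)))
      = ((volume : Measure ℝ).restrict (Ioo 0 S)).prod (volume : Measure (EuclideanSpace ℝ (Fin 3))) := by
    rw [hslab, show (volume : Measure (ℝ × EuclideanSpace ℝ (Fin 3)))
        = (volume : Measure ℝ).prod (volume : Measure (EuclideanSpace ℝ (Fin 3))) from rfl,
      ← Measure.restrict_univ (μ := (volume : Measure (EuclideanSpace ℝ (Fin 3)))),
      Measure.prod_restrict, Measure.restrict_univ]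
  have h2 : ∫⁻ z, ‖Function.uncurry v z‖ₑ ^ 2 ∂(volume.restrict slab) ≤ E₁ * volume (Ioo (0 : ℝ) S) := by
    have haem : AEMeasurable (fun z => ‖Function.uncurry v z‖ₑ ^ 2)
        (((volume : Measure ℝ).restrict (Ioo 0 S)).prod (volume : Measure (EuclideanSpace ℝ (Fin 3)))) := by
      rw [← hprod]; exact haesm.enorm.pow_const 2
    rw [hprod, lintegral_prod _ haem]
    calc ∫⁻ σ, ∫⁻ y, ‖Function.uncurry v (σ, y)‖ₑ ^ 2 ∂volume ∂((volume : Measure ℝ).restrict (Ioo 0 S))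
        ≤ ∫⁻ _σ, E₁ ∂((volume : Measure ℝ).restrict (Ioo 0 S)) := by
          refine lintegral_mono_ae ((ae_restrict_iff' measurableSet_Ioo).2 (Filter.Eventually.of_forall ?_))
          intro σ hσ
          simpa only [Function.uncurry_apply_pair] using hslice σ (Ioo_subset_Icc_self hσ)
      _ = E₁ * volume (Ioo (0 : ℝ) S) := by rw [lintegral_const, Measure.restrict_apply_univ]
  have h4 : ∫⁻ z, ‖Function.uncurry v z‖ₑ ^ (4 : ℝ) ∂(volume.restrict slab)
      ≤ ENNReal.ofReal (K ^ 2) * (E₁ * volume (Ioo (0 : ℝ) S)) := by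
    calc ∫⁻ z, ‖Function.uncurry v z‖ₑ ^ (4 : ℝ) ∂(volume.restrict slab)
        ≤ ∫⁻ z, ENNReal.ofReal (K ^ 2) * ‖Function.uncurry v z‖ₑ ^ 2 ∂(volume.restrict slab) := by
          refine lintegral_mono_ae ((ae_restrict_iff' hmeas_slab).2 (Filter.Eventually.of_forall ?_))
          intro z hz
          have hz1 : z.1 ∈ Icc 0 S := Ioo_subset_Icc_self (mem_prod.1 hz).1
          have hb : ‖Function.uncurry v z‖ₑ ≤ ENNReal.ofReal K := by
            rw [← ofReal_norm]
            exact ENNReal.ofReal_le_ofReal (hK z.1 hz1 z.2)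
          have e4 : ‖Function.uncurry v z‖ₑ ^ (4 : ℝ)
              = ‖Function.uncurry v z‖ₑ ^ 2 * ‖Function.uncurry v z‖ₑ ^ 2 := by
            rw [show (4 : ℝ) = ((4 : ℕ) : ℝ) by norm_num, ENNReal.rpow_natCast]; ring
          rw [e4]
          refine mul_le_mul' ?_ le_rfl
          calc ‖Function.uncurry v z‖ₑ ^ 2 ≤ (ENNReal.ofReal K) ^ 2 := pow_le_pow_left' hb 2
            _ = ENNReal.ofReal (K ^ 2) := by rw [ENNReal.ofReal_pow hK0]
      _ = ENNReal.ofReal (K ^ 2) * ∫⁻ z, ‖Function.uncurry v z‖ₑ ^ 2 ∂(volume.restrict slab) :=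
          lintegral_const_mul' _ _ ENNReal.ofReal_ne_top
      _ ≤ ENNReal.ofReal (K ^ 2) * (E₁ * volume (Ioo (0 : ℝ) S)) := mul_le_mul' le_rfl h2
  have htop : ∫⁻ z, ‖Function.uncurry v z‖ₑ ^ (4 : ℝ) ∂(volume.restrict slab) < ⊤ := by
    refine lt_of_le_of_lt h4 (ENNReal.mul_lt_top ENNReal.ofReal_lt_top (ENNReal.mul_lt_top hE₁.lt_top ?_))
    rw [Real.volume_Ioo]; exact ENNReal.ofReal_lt_top
  rw [eLpNorm_eq_lintegral_rpow_enorm_toReal (by norm_num) (by norm_num : (4 : ℝ≥0∞) ≠ ⊤), ENNReal.toReal_ofNat]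
  exact ENNReal.rpow_lt_top_of_nonneg (by norm_num) htop.ne

/-- **P♭ from P♭♭** (kernel-checked): boundedness (`sliceField_bound`), joint continuity (`sliceField_continuousOn`),
`L⁴` of the slab (`sliceField_memLp_four`) + the tree's `isSuitableWeakSolutionOn_slab_of_bounded_of_memLp_two` and
`isLocalEnergySolutionOn_of_bounded_suitable`. -/
theorem localEnergySliceLES_of_slicePressure (h : SlicePressure) : LocalEnergySliceLES := by
  intro M T τ u p hfr hτ hrate x tstar r S hr hS hS1 ht0 hrT hwin
  obtain ⟨π, hp2, hNS⟩ := h M T τ u p hfr hτ hrate x tstar r S hr hS hS1 ht0 hrT hwin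
  have hK := sliceField_bound hrate hτ x hr ht0 hwin
  have hcont := sliceField_continuousOn hfr.1 x hr hS ht0 hwin
  have hu4 := sliceField_memLp_four hfr hτ hrate x hr hS ht0 hwin
  have hsuit := isSuitableWeakSolutionOn_slab_of_bounded_of_memLp_two hS hK hNS hp2
  exact ⟨π, isLocalEnergySolutionOn_of_bounded_suitable hS hcont hK hu4 hp2 hsuit⟩

/-- **P from P♭** (v1.7, kernel-checked): the `E²` and uloc clauses of `LocalEnergySlice` are discharged by
`sliceField_memE2` / `sliceField_eLpNorm_unitBall_le` with `M̃(M) := C₊(M)^{1/2} + 1`, `C(M)` the I1 constant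
(`ThinCascade.stub_uniformScaledEnergy`, PROVED); only the local-energy-solution clause remains registered. -/
theorem localEnergySlice_of_les (hP : LocalEnergySliceLES) : LocalEnergySlice := by
  intro M
  obtain ⟨C, hC⟩ := stub_uniformScaledEnergy M
  refine ⟨(max C 0) ^ (1 / 2 : ℝ) + 1, by positivity, ?_⟩
  intro T τ u p hfr hτ hrate x tstar r S hr hS hS1 ht0 hrT hwin
  obtain ⟨π, hles⟩ := hP M T τ u p hfr hτ hrate x tstar r S hr hS hS1 ht0 hrT hwin
  have hSr : 0 ≤ S * r ^ 2 := by positivity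
  have htT : tstar ≤ T := by linarith
  refine ⟨π, hles, sliceField_memE2 hfr x hr ht0 htT, fun x₁ => ?_⟩
  exact (sliceField_eLpNorm_unitBall_le hC hfr hτ hrate x hr ht0 htT hrT x₁).trans
    (ENNReal.ofReal_le_ofReal (by linarith))

end PClauses

/-- **P♭♭ `SlicePressure` PROVED** — the pressure swap is done by the tree's very-weak ⇒ distributional machinery
(`isDistributionalNSSolutionOn_slab_of_veryWeak_four`), exactly as in `isDistributionalNSSolutionOn_slab_of_oseenForward`
with the Oseen-mild hypothesis replaced by classicality: `v` is a KNSS bounded weak solution on `(0,S)`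
(`IsClassicalNSSolutionOn.isBoundedWeakNSSolutionOn`: the classical pressure `q` drops out against divergence-free
tests), its slices are weakly divergence free, and the slab Riesz pressure `π ∈ L²` of `v ∈ L⁴` (`exists_rieszPressure_two_slab`)
solves the weak Poisson equation slice-wise. -/
theorem slicePressure_holds : SlicePressure := by
  intro M T τ u p hfr hτ hrate x tstar r S hr hS hS1 ht0 hrT hwin
  have hu4 := sliceField_memLp_four hfr hτ hrate x hr hS ht0 hwin
  obtain ⟨π, hπ2, hsl⟩ := exists_rieszPressure_two_slab hu4
  refine ⟨π, hπ2, ?_⟩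
  have hcl := sliceField_classical hfr.1 x hr hS ht0 hwin
  have hclo : IsClassicalNSSolutionOn (Ioo 0 S) 1 0 (sliceField u x tstar r) (r ^ 2 • stPull (r ^ 2) r tstar x p) :=
    hcl.mono Ioo_subset_Icc_self (uniqueDiffOn_Ioo 0 S)
  have hbd : IsBoundedOn (Ioo 0 S) (sliceField u x tstar r) :=
    ⟨M * r * τ ^ (-(1 / 2 : ℝ)), fun σ hσ y => sliceField_bound hrate hτ x hr ht0 hwin σ (Ioo_subset_Icc_self hσ) y⟩
  have hBW := hclo.isBoundedWeakNSSolutionOn hbd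
  have hu1 : LocallyIntegrableOn (Function.uncurry (sliceField u x tstar r))
      ((slab (EuclideanSpace ℝ (Fin 3)) (Ioo 0 S) isOpen_Ioo : TopologicalSpace.Opens (ℝ × (EuclideanSpace ℝ (Fin 3)))) :
        Set (ℝ × (EuclideanSpace ℝ (Fin 3)))) volume :=
    locallyIntegrableOn_slab_of_memLp hu4 (by norm_num)
  have hu2 : LocallyIntegrableOn (fun z => ‖Function.uncurry (sliceField u x tstar r) z‖ ^ 2)
      ((slab (EuclideanSpace ℝ (Fin 3)) (Ioo 0 S) isOpen_Ioo : TopologicalSpace.Opens (ℝ × (EuclideanSpace ℝ (Fin 3)))) :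
        Set (ℝ × (EuclideanSpace ℝ (Fin 3)))) volume :=
    locallyIntegrableOn_slab_of_memLp (memLp_norm_sq_of_memLp_four hu4) (by norm_num)
  have hp1 : LocallyIntegrableOn (Function.uncurry π)
      ((slab (EuclideanSpace ℝ (Fin 3)) (Ioo 0 S) isOpen_Ioo : TopologicalSpace.Opens (ℝ × (EuclideanSpace ℝ (Fin 3)))) :
        Set (ℝ × (EuclideanSpace ℝ (Fin 3)))) volume :=
    locallyIntegrableOn_slab_of_memLp hπ2 (by norm_num)
  refine isDistributionalNSSolutionOn_slab_of_veryWeak_four hu4 hπ2 (fun θ hθ => ?_) (fun θ hθ => ?_)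
    (fun ψ hψ hdivψ => ?_)
  · exact setIntegral_inner_gradient_eq_zero_of_forall_isWeaklyDivFree hu1
      (fun t ht => VectorCalculus.IsDivFree.isWeaklyDivFree_holds (hcl.divFree t ht)
        (contDiff_infty.1 (hcl.contDiff_velocity ht) 1)) hθ
  · exact setIntegral_pressure_laplacian_eq_of_ae_slice hu1 hu2 hp1 (hsl.mono fun t ht => ht.2) hθ
  · exact setIntegral_veryWeak_eq_zero_of_iterated hu1 hu2 hψ (hBW.2.2.2 ψ hψ hdivψ)

/-- P♭♭ — `SlicePressure`: **PROVED (v1.11)** by `slicePressure_holds`; the registered name is kept as a sorry-free alias. -/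
theorem stub_slicePressure : SlicePressure :=
  slicePressure_holds

/-- P♭ — the local-energy-solution clause (§10, `LocalEnergySliceLES`): DERIVED (v1.8) from P♭♭ by
`localEnergySliceLES_of_slicePressure` (boundedness, joint continuity, `L⁴(slab)` PROVED in §10a + the tree's
`isSuitableWeakSolutionOn_slab_of_bounded_of_memLp_two` / `isLocalEnergySolutionOn_of_bounded_suitable`). -/
theorem stub_localEnergySliceLES : LocalEnergySliceLES :=
  localEnergySliceLES_of_slicePressure stub_slicePressure

/-- P — the shared plumbing lemma `LocalEnergySlice` (§10): DERIVED (v1.7) from P♭ by `localEnergySlice_of_les`. -/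
theorem stub_localEnergySlice : LocalEnergySlice :=
  localEnergySlice_of_les stub_localEnergySliceLES


end

end Summit.NavierStokesRegularity.NavierStokesRegularity.Cruxes.TypeIQuantSubcubicExp.FlatChain
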